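import Summits.ValiantsHypothesis.ValiantsHypothesis.Theorems.EquivariantDialPolyPermifyPairs
import Summits.ValiantsHypothesis.ValiantsHypothesis.Theorems.SymPencilEquivariantSdcNotQPYoungFixedVectorSpecht
import HarnessLib

/-!
# Equivariant dial — polynomial permify, file C: the mixed Young eigenvector and a fixing subgroup of polynomial index

Offer O-L1-29 «POLYNOMIAL PERMIFY» (decomposition workshop, lineage `decomp-val-lens-1`, g37;
RULING bus 3382), file C of five.

**`exists_fixed_of_pair`.** For a commuting pair `R ≤ R_μ`, `C ≤ C_μ` (file B) the vector
`w := B_C · c_μ ∈ S^μ = ℂ[𝔖_n] c_μ`, `B_C := ∑_{c ∈ C} sgn(c) c`, is nonzero, fixed by `R`, and an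
eigenvector of `C` with eigencharacter `sgn`: `r · w = B_C · (r c_μ) = w` because `r` commutes with
`B_C` and `r c_μ = c_μ` (`of_mul_youngSymmetrizer`); `c₀ · B_C = sgn(c₀) B_C` by reindexing; and
`c_μ · w = |C| · c_μ² = |C| · n_μ · c_μ ≠ 0` (`colAntisymmetrizer_mul_of`, `youngSymmetrizer_sq`,
`n_μ ≠ 0` in characteristic zero, `c_μ ≠ 0`).

**`exists_polyIndex_fixed`.** With the pair of file B (`n! ≤ (f^μ)^4 |R| |C|`), the subgroup
`P := R · C⁺`, `C⁺ := C ∩ 𝔄_n` (`|C| ≤ 2 |C⁺|`, `R ∩ C⁺ ⊆ R_μ ∩ C_μ = 1`), has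
`[𝔖_n : P] = n! / (|R| |C⁺|) ≤ 2 (f^μ)^4` and FIXES `w` (the sign character is trivial on `C⁺`).
This is the `𝔖_n`-side input of the polynomial permify: a fixed vector of polynomial co-volume in
EVERY Specht module, uniformly in the shape.

HONEST BOUNDARY: 0 S-currency; closes NO item; infrastructure for O-L1-29 (RULING bus 3382);
pure `𝔖_n`-representation theory — no dial claim is made in this file; stmt-23702 / VP ≠ VNP
untouched.

References: Young symmetrizers and Specht modules [cite: JamesKerber1981, 1.5 and 7.1]; hook
length formula [cite: FrameRobinsonThrallCJM1954, Theorem 1]; the orbit-closure / symmetry context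
of the dial [cite: LandsbergRessayre2017, Theorem 2.5.5] [cite: DawarWilsenach2025, Theorem 2].
Theorems only; no definitions.
-/

set_option linter.dupNamespace false

namespace Summit.ValiantsHypothesis.ValiantsHypothesis.Theorems.EquivariantDialPolyPermify

open Literature.NumberTheory.DiophantineGeometry
open Summit.ValiantsHypothesis.ValiantsHypothesis.Theorems.SymPencilEquivariantSdcNotQP.YoungBounds

/-! ### Signed sums in the group algebra -/

section GroupAlgebra

variable {n : ℕ}

/-- If `r` commutes with every element of `S`, then `r` commutes with the signed sum
`B_S = ∑_{c ∈ S} sgn(c) c` in `ℂ[𝔖_n]`. [folklore] -/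
theorem of_mul_signedSum_of_forall_commute (S : Finset (Equiv.Perm (Fin n)))
    (r : Equiv.Perm (Fin n)) (hrc : ∀ c ∈ S, r * c = c * r) :
    MonoidAlgebra.of ℂ _ r *
        (∑ c ∈ S, ((Equiv.Perm.sign c : ℤ) : ℂ) • MonoidAlgebra.of ℂ (Equiv.Perm (Fin n)) c) =
      (∑ c ∈ S, ((Equiv.Perm.sign c : ℤ) : ℂ) • MonoidAlgebra.of ℂ (Equiv.Perm (Fin n)) c) *
        MonoidAlgebra.of ℂ _ r := by
  rw [Finset.mul_sum, Finset.sum_mul]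
  refine Finset.sum_congr rfl fun c hc => ?_
  rw [mul_smul_comm, smul_mul_assoc, ← map_mul, ← map_mul, hrc c hc]

/-- `c₀ · B_S = sgn(c₀) B_S` when `S` is stable under left multiplication by `c₀` (e.g. `S` a
subgroup containing `c₀`): reindex `c ↦ c₀ c` (companion of the tree's `of_mul_colAntisymmetrizer`).
[folklore] -/
theorem of_mul_signedSum_of_mul_mem_iff (S : Finset (Equiv.Perm (Fin n))) (c₀ : Equiv.Perm (Fin n))
    (hS : ∀ c, c₀ * c ∈ S ↔ c ∈ S) :
    MonoidAlgebra.of ℂ _ c₀ *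
        (∑ c ∈ S, ((Equiv.Perm.sign c : ℤ) : ℂ) • MonoidAlgebra.of ℂ (Equiv.Perm (Fin n)) c) =
      ((Equiv.Perm.sign c₀ : ℤ) : ℂ) •
        ∑ c ∈ S, ((Equiv.Perm.sign c : ℤ) : ℂ) • MonoidAlgebra.of ℂ (Equiv.Perm (Fin n)) c := by
  have ht : ((Equiv.Perm.sign c₀ : ℤ) : ℂ) * ((Equiv.Perm.sign c₀ : ℤ) : ℂ) = 1 := by
    rw [← Int.cast_mul, ← Units.val_mul, Int.units_mul_self, Units.val_one, Int.cast_one]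
  rw [Finset.mul_sum, Finset.smul_sum]
  refine Finset.sum_equiv (Equiv.mulLeft c₀) (fun σ => ?_) (fun σ _ => ?_)
  · rw [Equiv.coe_mulLeft]
    exact (hS σ).symm
  · rw [Equiv.coe_mulLeft, mul_smul_comm, smul_smul, map_mul, map_mul, Units.val_mul,
      Int.cast_mul, ← mul_assoc, ht, one_mul]

/-- `b_μ · B_S = |S| · b_μ` when `S ⊆ C_μ`: each `b_μ · sgn(c) c = sgn(c)² b_μ = b_μ`
(`colAntisymmetrizer_mul_of`). [folklore] -/
theorem colAntisymmetrizer_mul_signedSum (μ : Nat.Partition n) (S : Finset (Equiv.Perm (Fin n)))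
    (hS : ∀ c ∈ S, c ∈ colStabilizer μ) :
    colAntisymmetrizer ℂ μ *
        (∑ c ∈ S, ((Equiv.Perm.sign c : ℤ) : ℂ) • MonoidAlgebra.of ℂ (Equiv.Perm (Fin n)) c) =
      (S.card : ℂ) • colAntisymmetrizer ℂ μ := by
  rw [Finset.mul_sum]
  have h : ∀ c ∈ S, colAntisymmetrizer ℂ μ *
      (((Equiv.Perm.sign c : ℤ) : ℂ) • MonoidAlgebra.of ℂ (Equiv.Perm (Fin n)) c) =
        colAntisymmetrizer ℂ μ := by
    intro c hc
    rw [mul_smul_comm, colAntisymmetrizer_mul_of (hS c hc), smul_smul, ← Int.cast_mul,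
      ← Units.val_mul, Int.units_mul_self, Units.val_one, Int.cast_one, one_smul]
  rw [Finset.sum_congr rfl h, Finset.sum_const, ← Nat.cast_smul_eq_nsmul ℂ]

end GroupAlgebra

/-! ### The mixed Young eigenvector -/

/-- **The mixed Young eigenvector.** For commuting `R ≤ R_μ`, `C ≤ C_μ`, the Specht module
`S^μ = ℂ[𝔖_n] c_μ` contains `w ≠ 0` with `r w = w` (`r ∈ R`) and `c w = sgn(c) w` (`c ∈ C`), namely
`w = (∑_{c ∈ C} sgn(c) c) · c_μ`. [cite: JamesKerber1981, 1.5 and 7.1] -/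
theorem exists_fixed_of_pair {n : ℕ} (μ : Nat.Partition n) (R C : Subgroup (Equiv.Perm (Fin n)))
    (hR : R ≤ rowStabilizer μ) (hC : C ≤ colStabilizer μ) (hRC : ∀ r ∈ R, ∀ c ∈ C, r * c = c * r) :
    ∃ w : spechtIdeal ℂ μ, w ≠ 0 ∧ (∀ r ∈ R, spechtRep ℂ μ r w = w) ∧
      ∀ c ∈ C, spechtRep ℂ μ c w = ((Equiv.Perm.sign c : ℤ) : ℂ) • w := by
  classical
  set S : Finset (Equiv.Perm (Fin n)) := (C : Set (Equiv.Perm (Fin n))).toFinset with hS_def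
  have hS : ∀ c, c ∈ S ↔ c ∈ C := fun c => by rw [hS_def, Set.mem_toFinset, SetLike.mem_coe]
  set B : MonoidAlgebra ℂ (Equiv.Perm (Fin n)) :=
    ∑ c ∈ S, ((Equiv.Perm.sign c : ℤ) : ℂ) • MonoidAlgebra.of ℂ (Equiv.Perm (Fin n)) c with hB
  refine ⟨⟨B * youngSymmetrizer ℂ μ, Ideal.mul_mem_left _ _ (youngSymmetrizer_mem_spechtIdeal ℂ μ)⟩,
    ?_, ?_, ?_⟩
  · -- nonzero: `c_μ (B c_μ) = |C| n_μ c_μ ≠ 0`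
    intro h0
    have h0' : B * youngSymmetrizer ℂ μ = 0 := congrArg Subtype.val h0
    have hbB : colAntisymmetrizer ℂ μ * B = (S.card : ℂ) • colAntisymmetrizer ℂ μ :=
      colAntisymmetrizer_mul_signedSum μ S fun c hc => hC ((hS c).mp hc)
    have key : youngSymmetrizer ℂ μ * (B * youngSymmetrizer ℂ μ) =
        (S.card : ℂ) • (youngSymmetrizer ℂ μ * youngSymmetrizer ℂ μ) := by
      calc youngSymmetrizer ℂ μ * (B * youngSymmetrizer ℂ μ)
          = rowSymmetrizer ℂ μ * (colAntisymmetrizer ℂ μ * B) * youngSymmetrizer ℂ μ := by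
            simp only [youngSymmetrizer, mul_assoc]
        _ = (S.card : ℂ) • (youngSymmetrizer ℂ μ * youngSymmetrizer ℂ μ) := by
            rw [hbB, mul_smul_comm, smul_mul_assoc]
            simp only [youngSymmetrizer, mul_assoc]
    rw [h0', mul_zero, youngSymmetrizer_sq] at key
    have hS1 : (S.card : ℂ) ≠ 0 := by
      rw [Nat.cast_ne_zero]
      exact Finset.card_ne_zero_of_mem ((hS 1).mpr (one_mem C))
    rcases smul_eq_zero.mp key.symm with h | h
    · exact hS1 h
    · rcases smul_eq_zero.mp h with h | h
      · exact coeff_sq_youngSymmetrizer_ne_zero ℂ μ h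
      · exact youngSymmetrizer_ne_zero_holds (k := ℂ) μ h
  · -- fixed by `R`
    intro r hr
    apply Subtype.ext
    rw [spechtRep_apply]
    change MonoidAlgebra.of ℂ _ r * (B * youngSymmetrizer ℂ μ) = B * youngSymmetrizer ℂ μ
    rw [← mul_assoc, hB, of_mul_signedSum_of_forall_commute S r (fun c hc => hRC r hr c ((hS c).mp hc)),
      mul_assoc, of_mul_youngSymmetrizer (hR hr)]
  · -- sign eigenvector for `C`
    intro c₀ hc₀
    apply Subtype.ext
    rw [spechtRep_apply, Submodule.coe_smul_of_tower]
    change MonoidAlgebra.of ℂ _ c₀ * (B * youngSymmetrizer ℂ μ) =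
      ((Equiv.Perm.sign c₀ : ℤ) : ℂ) • (B * youngSymmetrizer ℂ μ)
    have hstab : ∀ c, c₀ * c ∈ S ↔ c ∈ S := fun c => by
      rw [hS, hS]
      exact ⟨fun h => by simpa using C.mul_mem (C.inv_mem hc₀) h, fun h => C.mul_mem hc₀ h⟩
    rw [← mul_assoc, hB, of_mul_signedSum_of_mul_mem_iff S c₀ hstab, smul_mul_assoc]

/-! ### A fixing subgroup of polynomial index -/

/-- **Polynomial-index fixed vectors in every Specht module.** For every `μ ⊢ n` there is a subgroup
`P ≤ 𝔖_n` of index `[𝔖_n : P] ≤ 2 (f^μ)^4` fixing a nonzero vector of `S^μ`: `P = R · (C ∩ 𝔄_n)` for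
the commuting pair of `exists_commuting_pair`, acting trivially on the mixed Young eigenvector.
[cite: JamesKerber1981, 1.5 and 7.1] [cite: FrameRobinsonThrallCJM1954, Theorem 1] -/
theorem exists_polyIndex_fixed {n : ℕ} (μ : Nat.Partition n) :
    ∃ P : Subgroup (Equiv.Perm (Fin n)), P.index ≤ 2 * numStandardTableaux μ ^ 4 ∧
      ∃ w : spechtIdeal ℂ μ, w ≠ 0 ∧ ∀ p ∈ P, spechtRep ℂ μ p w = w := by
  obtain ⟨R, C, hR, hC, hRC, hineq⟩ := exists_commuting_pair μ
  obtain ⟨w, hw0, hwR, hwC⟩ := exists_fixed_of_pair μ R C hR hC hRC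
  -- the even part `C⁺` of `C`
  let ψ : C →* ℤˣ := Equiv.Perm.sign.comp C.subtype
  let Cp : Subgroup (Equiv.Perm (Fin n)) := ψ.ker.map C.subtype
  have hCpC : Cp ≤ C := by
    rintro _ ⟨c, _, rfl⟩
    exact c.2
  have hCpsign : ∀ c ∈ Cp, Equiv.Perm.sign c = 1 := by
    rintro _ ⟨c, hc, rfl⟩
    simpa [ψ, MonoidHom.mem_ker] using hc
  have hcardC : Nat.card C ≤ 2 * Nat.card Cp := by
    have h1 : Nat.card Cp = Nat.card ψ.ker := Subgroup.card_map_of_injective C.subtype_injective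
    have h2 := Subgroup.card_mul_index ψ.ker
    have h3 : ψ.ker.index ≤ 2 := by
      rw [Subgroup.index_ker]
      calc Nat.card ψ.range ≤ Nat.card ℤˣ :=
            Nat.card_le_card_of_injective ψ.range.subtype ψ.range.subtype_injective
        _ = 2 := by rw [Nat.card_eq_fintype_card, Fintype.card_units_int]
    calc Nat.card C = Nat.card ψ.ker * ψ.ker.index := h2.symm
      _ ≤ Nat.card ψ.ker * 2 := Nat.mul_le_mul_left _ h3
      _ = 2 * Nat.card Cp := by rw [h1, mul_comm]
  -- the product subgroup `P = R · C⁺`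
  have hcomm : ∀ (r : R) (c : Cp), Commute (R.subtype r) (Cp.subtype c) :=
    fun r c => hRC r r.2 c (hCpC c.2)
  let φ : R × Cp →* Equiv.Perm (Fin n) := MonoidHom.noncommCoprod R.subtype Cp.subtype hcomm
  have hφ : ∀ x : R × Cp, φ x = (x.1 : Equiv.Perm (Fin n)) * x.2 := fun x => rfl
  have hφinj : Function.Injective φ := by
    intro x y h
    rw [hφ, hφ] at h
    -- `y₁⁻¹ x₁ = y₂ x₂⁻¹ ∈ R ∩ C ≤ R_μ ∩ C_μ = 1`
    have h1 : (y.1 : Equiv.Perm (Fin n))⁻¹ * x.1 =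
        (y.2 : Equiv.Perm (Fin n)) * (x.2 : Equiv.Perm (Fin n))⁻¹ := by
      rw [inv_mul_eq_iff_eq_mul, ← mul_assoc, eq_mul_inv_iff_mul_eq]
      exact h
    have hmem : (y.1 : Equiv.Perm (Fin n))⁻¹ * x.1 ∈ rowStabilizer μ ⊓ colStabilizer μ :=
      ⟨hR (mul_mem (inv_mem y.1.2) x.1.2),
        by rw [h1]; exact hC (hCpC (mul_mem y.2.2 (inv_mem x.2.2)))⟩
    rw [rowStabilizer_inf_colStabilizer, Subgroup.mem_bot] at hmem
    have e1 : (x.1 : Equiv.Perm (Fin n)) = y.1 := (inv_mul_eq_one.mp hmem).symm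
    rw [hmem] at h1
    have e2 : (x.2 : Equiv.Perm (Fin n)) = y.2 := (mul_inv_eq_one.mp h1.symm).symm
    exact Prod.ext (Subtype.ext e1) (Subtype.ext e2)
  refine ⟨φ.range, ?_, w, hw0, ?_⟩
  · -- the index of `P`
    have hcardP : Nat.card φ.range = Nat.card R * Nat.card Cp := by
      rw [← Nat.card_prod]
      exact (Nat.card_congr (MonoidHom.ofInjective hφinj).toEquiv).symm
    have hPi := Subgroup.card_mul_index φ.range
    have hSn : Nat.card (Equiv.Perm (Fin n)) = n.factorial := by
      rw [Nat.card_eq_fintype_card, Fintype.card_perm, Fintype.card_fin]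
    have hpos : 0 < Nat.card R * Nat.card Cp := Nat.mul_pos Nat.card_pos Nat.card_pos
    have key : Nat.card R * Nat.card Cp * φ.range.index ≤
        Nat.card R * Nat.card Cp * (2 * numStandardTableaux μ ^ 4) := by
      calc Nat.card R * Nat.card Cp * φ.range.index = n.factorial := by rw [← hcardP, hPi, hSn]
        _ ≤ numStandardTableaux μ ^ 4 * (Nat.card R * Nat.card C) := hineq
        _ ≤ numStandardTableaux μ ^ 4 * (Nat.card R * (2 * Nat.card Cp)) := by gcongr
        _ = Nat.card R * Nat.card Cp * (2 * numStandardTableaux μ ^ 4) := by ring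
    exact Nat.le_of_mul_le_mul_left key hpos
  · -- `P` fixes `w`
    rintro _ ⟨x, rfl⟩
    rw [hφ, map_mul, Module.End.mul_apply, hwC _ (hCpC x.2.2), hCpsign _ x.2.2, Units.val_one,
      Int.cast_one, one_smul, hwR _ x.1.2]

end Summit.ValiantsHypothesis.ValiantsHypothesis.Theorems.EquivariantDialPolyPermify
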